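import Summits.ValiantsHypothesis.ValiantsHypothesis.Theses.FeketeSOS
import Summits.ValiantsHypothesis.ValiantsHypothesis.Theorems.FeketeNoSparseSplit.Negative.SmallModels
import Literature.NumberTheory.LFunctions.FeketePolynomial

/-!
# `FeketeNoSparseSplit` (crux stmt-ValiantsHypothesis-3997): the peel deficiency is UNBOUNDED —
for every `K`, the strengthening "`|supp A| + |supp B| ≥ p - K` for all large `p`" is FALSE (cdisprove cycle 4)

Negative-side fact (refuter-cdisprove, standing adversary of the crux), PROVED, no new facts.  The crux itself is a
theorem (line `cyclic-valuation-dichotomy`: `≥ (p+3)/2`); the exhaustive data (`p ≤ 29`) show the TRUE minimum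
support-sum of a complex splitting `A·B = F_p` is `p - O(#zeros of S_p)`, `S_p(n) = Σ_{m ≤ n} (m|p)`, attained by the
peel `F_p = (X - X²)·Σ_k S_p(k+1) X^k` (`SmallModels.peel_split`).  `PeelDeficiency.lean` refuted `≥ p - 2`
eventually (three forced zeros along `p ≡ 5 (mod 8)`).  This file removes EVERY constant (it imports only
`SmallModels.peel_split`; the two one-line evaluations `(2|p) = -1` for `p ≡ 5 (8)` and `S_p(2) = 0` are restated here as
`legendreSym_two_of_mod_eight_eq_five`, `legendreSym_partial_sum_two_eq_zero` to keep the import closure minimal):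

* `not_eventually_ge_sub_const` — for every `K : ℕ`,
  `¬ ∃ p₀, ∀ primes p ≥ p₀, ∀ A B, A·B = F_p → p - K ≤ |supp A| + |supp B|`.

Mechanism (Legendre symbols imitating `χ₄`; quadratic reciprocity + CRT + Dirichlet, all from Mathlib):
* `exists_prime_five_mod_eight_and_neg_one_mod` — beyond any bound there is a prime `p ≡ 5 (mod 8)` with
  `p ≡ -1 (mod q)` for every odd prime `q ≤ N` (CRT for `8` and `D = ∏ q`, then Dirichlet in the class mod `8D`);
* `legendreSym_eq_chi4_of_neg_one_mod` — for such `p`: `(q|p) = (p|q) = (-1|q) = χ₄(q)` (reciprocity, `p ≡ 1 (4)`),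
  and `(2|p) = -1`; `legendreSym_eq_chi4_of_prime` — hence `(m|p) = χ₄(m)` for all odd `m ≤ N` (multiplicativity);
* `sum_legendreSym_two_pow_succ_eq_zero` — a `χ₄`-patterned symbol has `S_p(2^j) = 0` for `1 ≤ j`, `2^j ≤ N`:
  pairing `m = 2i+1, 2i+2` gives `S_p(2n) = Σ_{i<n} χ₄(2i+1) - S_p(n) = [n odd] - S_p(n)`, and `S_p(2) = 0`;
* with `N = 2^{K+1}` the peel cofactor has `≥ K+1` vanishing coefficients, support-sum `≤ p - K - 1`.

So along a (very sparse: `p ≫ exp(2^K)`) sequence of primes the deficiency `p - min` exceeds any constant; with the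
numerics of `Disproof.lean` §B2 (mean `#zeros ≈ 1.28 √p`) the truth is `p - Θ(√p)` typically, `≥ (p+3)/2` always, and
no bound of the form `p - O(1)` holds.  (Positive by-product, purely about Legendre symbols:
`exists_prime_legendre_partial_sums_vanish` — for every `K, n₀` there is a prime `p > n₀` with
`S_p(2) = S_p(4) = ⋯ = S_p(2^{K+1}) = 0`.)
-/

namespace Summit.ValiantsHypothesis.Theorems.FeketeNoSparseSplit.Negative

open Polynomial Finset

section UnboundedDeficiency

/-! ### 0. Two evaluations -/

/-- `χ_p(2) = -1` for `p ≡ 5 (mod 8)` (second supplement). -/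
theorem legendreSym_two_of_mod_eight_eq_five (p : ℕ) [Fact p.Prime] (h8 : p % 8 = 5) : legendreSym p 2 = -1 := by
  have hp2 : p ≠ 2 := by rintro rfl; norm_num at h8
  rw [legendreSym.at_two hp2, ZMod.χ₈_nat_eq_if_mod_eight]
  have hodd : p % 2 ≠ 0 := by omega
  rw [if_neg hodd, if_neg (by omega)]

/-- `S_p(2) = χ_p(0) + χ_p(1) + χ_p(2) = 0` when `χ_p(2) = -1`. -/
theorem legendreSym_partial_sum_two_eq_zero (p : ℕ) [Fact p.Prime] (h2 : legendreSym p 2 = -1) :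
    ∑ m ∈ range 3, legendreSym p m = 0 := by
  simp [Finset.sum_range_succ, legendreSym.at_zero, legendreSym.at_one]
  rw [h2]
  norm_num

/-! ### 1. Partial sums of a `χ₄`-patterned Legendre symbol vanish at the powers of two -/

/-- Pairing a range sum of odd length: `Σ_{m ≤ 2n} g m = g 0 + Σ_{i<n} (g (2i+1) + g (2i+2))`. -/
theorem sum_range_two_mul_add_one (g : ℕ → ℤ) (n : ℕ) :
    ∑ m ∈ range (2 * n + 1), g m = g 0 + ∑ i ∈ range n, (g (2 * i + 1) + g (2 * i + 2)) := by
  induction n with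
  | zero => simp
  | succ n ih =>
    rw [show 2 * (n + 1) + 1 = 2 * n + 1 + 1 + 1 by ring, sum_range_succ, sum_range_succ, ih,
      sum_range_succ, show 2 * n + 1 + 1 = 2 * n + 2 by ring]
    ring

/-- `Σ_{i<2k} χ₄(2i+1) = 0` and `Σ_{i ≤ 2k} χ₄(2i+1) = 1` (the values alternate `1, -1, 1, -1, …`). -/
theorem sum_range_chi4_odd (k : ℕ) :
    (∑ i ∈ range (2 * k), ZMod.χ₄ ((2 * i + 1 : ℕ) : ZMod 4)) = 0 ∧
    (∑ i ∈ range (2 * k + 1), ZMod.χ₄ ((2 * i + 1 : ℕ) : ZMod 4)) = 1 := by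
  induction k with
  | zero => simp
  | succ k ih =>
    have hA : (∑ i ∈ range (2 * (k + 1)), ZMod.χ₄ ((2 * i + 1 : ℕ) : ZMod 4)) = 0 := by
      rw [show 2 * (k + 1) = 2 * k + 1 + 1 by ring, sum_range_succ, ih.2,
        ZMod.χ₄_nat_three_mod_four (by omega : (2 * (2 * k + 1) + 1) % 4 = 3)]
      norm_num
    refine ⟨hA, ?_⟩
    rw [sum_range_succ, hA, ZMod.χ₄_nat_one_mod_four (by omega : (2 * (2 * (k + 1)) + 1) % 4 = 1)]
    norm_num

variable (p : ℕ) [Fact p.Prime]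

/-- **Zeros at the powers of two.**  If `χ_p(2) = -1` and `χ_p(m) = χ₄(m)` for all odd `m ≤ N`, then
`S_p(2^{i+1}) = Σ_{m ≤ 2^{i+1}} (m|p) = 0` whenever `2^{i+1} ≤ N`.  (Induction: pairing `m = 2i'+1, 2i'+2` gives
`S_p(2n) = Σ_{i'<n} χ₄(2i'+1) - S_p(n)`, the first sum vanishes for even `n`, and `S_p(2) = 0 + 1 - 1 = 0`.) -/
theorem sum_legendreSym_two_pow_succ_eq_zero (N : ℕ) (h2 : legendreSym p 2 = -1)
    (hodd : ∀ m : ℕ, m ≤ N → m % 2 = 1 → legendreSym p m = ZMod.χ₄ (m : ZMod 4)) :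
    ∀ i : ℕ, 2 ^ (i + 1) ≤ N → ∑ m ∈ range (2 ^ (i + 1) + 1), legendreSym p m = 0 := by
  intro i
  induction i with
  | zero =>
    intro _
    exact legendreSym_partial_sum_two_eq_zero p h2
  | succ i ih =>
    intro hN
    have hle : 2 ^ (i + 1) ≤ N := le_trans (Nat.pow_le_pow_right (by norm_num) (by omega)) hN
    have ih' := ih hle
    -- `2^(i+2) = 2·n` with `n = 2^(i+1) = 2·2^i` even
    have hn2 : 2 ^ (i + 1 + 1) = 2 * 2 ^ (i + 1) := by ring
    rw [hn2, sum_range_two_mul_add_one]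
    have hpair : ∀ i' ∈ range (2 ^ (i + 1)),
        legendreSym p ((2 * i' + 1 : ℕ) : ℤ) + legendreSym p ((2 * i' + 2 : ℕ) : ℤ) =
          ZMod.χ₄ ((2 * i' + 1 : ℕ) : ZMod 4) - legendreSym p ((i' + 1 : ℕ) : ℤ) := by
      intro i' hi'
      rw [mem_range] at hi'
      rw [hodd (2 * i' + 1) (by omega) (by omega)]
      have hc : ((2 * i' + 2 : ℕ) : ℤ) = 2 * ((i' + 1 : ℕ) : ℤ) := by push_cast; ring
      rw [hc, legendreSym.mul, h2]
      ring
    rw [sum_congr rfl hpair, sum_sub_distrib]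
    have hchi : (∑ i' ∈ range (2 ^ (i + 1)), ZMod.χ₄ ((2 * i' + 1 : ℕ) : ZMod 4)) = 0 := by
      rw [show 2 ^ (i + 1) = 2 * 2 ^ i by ring]
      exact (sum_range_chi4_odd (2 ^ i)).1
    have hshift : (∑ i' ∈ range (2 ^ (i + 1)), legendreSym p ((i' + 1 : ℕ) : ℤ)) = 0 := by
      have h := Finset.sum_range_succ' (fun m : ℕ => legendreSym p (m : ℤ)) (2 ^ (i + 1))
      rw [ih'] at h
      simp only [Nat.cast_zero, legendreSym.at_zero, add_zero] at h
      exact h.symm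
    rw [hchi, hshift]
    simp [legendreSym.at_zero]

/-! ### 2. From the primes to all odd `m ≤ N` (multiplicativity) -/

/-- If `(q|p) = χ₄(q)` for every odd prime `q ≤ N`, then `(m|p) = χ₄(m)` for every odd `m ≤ N`. -/
theorem legendreSym_eq_chi4_of_prime (N : ℕ)
    (hq : ∀ q : ℕ, q.Prime → q ≤ N → q % 2 = 1 → legendreSym p q = ZMod.χ₄ (q : ZMod 4)) :
    ∀ m : ℕ, m ≤ N → m % 2 = 1 → legendreSym p m = ZMod.χ₄ (m : ZMod 4) := by
  intro m
  induction m using Nat.strong_induction_on with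
  | _ m ih =>
    intro hmN hm2
    by_cases hm1 : m = 1
    · subst hm1
      simp [legendreSym.at_one]
    · obtain ⟨q, hqp, r, hr⟩ := Nat.exists_prime_and_dvd hm1
      have hq2 : q % 2 = 1 := by
        rcases Nat.mod_two_eq_zero_or_one q with h | h
        · exfalso
          have h2m : 2 ∣ m := dvd_trans (Nat.dvd_of_mod_eq_zero h) ⟨r, hr⟩
          omega
        · exact h
      have hr2 : r % 2 = 1 := by
        rcases Nat.mod_two_eq_zero_or_one r with h | h
        · exfalso
          have h2m : 2 ∣ m := dvd_trans (Nat.dvd_of_mod_eq_zero h) ⟨q, by rw [hr]; ring⟩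
          omega
        · exact h
      have hm0 : 0 < m := by omega
      have hqle : q ≤ m := Nat.le_of_dvd hm0 ⟨r, hr⟩
      have hrpos : 0 < r := by
        rcases Nat.eq_zero_or_pos r with h | h
        · rw [h, mul_zero] at hr; omega
        · exact h
      have hrlt : r < m := by
        rw [hr]
        have h2q : 2 ≤ q := hqp.two_le
        nlinarith
      rw [hr, Nat.cast_mul, legendreSym.mul, Nat.cast_mul, map_mul, hq q hqp (by omega) hq2,
        ih r hrlt (by omega) hr2]

/-! ### 3. The primes: `p ≡ 5 (mod 8)`, `p ≡ -1 (mod q)` for all odd primes `q ≤ N` (CRT + Dirichlet) -/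

/-- Beyond any bound there is a prime `p ≡ 5 (mod 8)` with `p ≡ -1 (mod q)` for every odd prime `q ≤ N`. -/
theorem exists_prime_five_mod_eight_and_neg_one_mod (N n₀ : ℕ) :
    ∃ p : ℕ, n₀ < p ∧ p.Prime ∧ p % 8 = 5 ∧ ∀ q : ℕ, q.Prime → q ≤ N → q % 2 = 1 → p % q = q - 1 := by
  classical
  set T : Finset ℕ := (range (N + 1)).filter (fun q => q.Prime ∧ q % 2 = 1) with hT
  set D : ℕ := ∏ q ∈ T, q with hD
  have hTmem : ∀ q, q ∈ T ↔ q < N + 1 ∧ q.Prime ∧ q % 2 = 1 := fun q => by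
    rw [hT, mem_filter, mem_range]
  have hDpos : 0 < D := prod_pos fun q hq => ((hTmem q).1 hq).2.1.pos
  have hDodd : D % 2 = 1 := by
    rw [hD, prod_nat_mod, prod_eq_one (fun q hq => ((hTmem q).1 hq).2.2)]
    norm_num
  have h2D : Nat.Coprime 2 D := (Nat.prime_two.coprime_iff_not_dvd).2 (by omega)
  have h8D : Nat.Coprime 8 D := by
    have h := Nat.Coprime.pow_left 3 h2D
    norm_num at h
    exact h
  obtain ⟨k, hk8, hkD⟩ := Nat.chineseRemainder h8D 5 (D - 1)
  have hk5 : k % 8 = 5 := by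
    have h := hk8
    unfold Nat.ModEq at h
    norm_num at h
    exact h
  have hkco : k.Coprime (8 * D) := by
    apply Nat.Coprime.mul_right
    · have h2 : Nat.Coprime k 2 := Nat.coprime_comm.1 ((Nat.prime_two.coprime_iff_not_dvd).2 (by omega))
      have h := Nat.Coprime.pow_right 3 h2
      norm_num at h
      exact h
    · have h1 : Nat.Coprime (D - 1) D :=
        (Nat.coprime_self_sub_left (by omega : 1 ≤ D)).2 (Nat.coprime_one_left D)
      have hg := Nat.ModEq.gcd_eq hkD
      unfold Nat.Coprime at h1 ⊢
      rw [hg]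
      exact h1
  obtain ⟨p, hpn, hpp, hpk⟩ :=
    Nat.forall_exists_prime_gt_and_modEq (n₀ + N) (q := 8 * D) (a := k) (by positivity) hkco
  refine ⟨p, by omega, hpp, ?_, ?_⟩
  · have h8 : p ≡ 5 [MOD 8] := (Nat.ModEq.of_mul_right D hpk).trans hk8
    unfold Nat.ModEq at h8
    norm_num at h8
    exact h8
  · intro q hq hqN hq2
    have hqT : q ∈ T := (hTmem q).2 ⟨by omega, hq, hq2⟩
    have hqD : q ∣ D := dvd_prod_of_mem _ hqT
    have hmod : p ≡ D - 1 [MOD q] := Nat.ModEq.of_dvd hqD ((Nat.ModEq.of_mul_left 8 hpk).trans hkD)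
    obtain ⟨e, he⟩ := hqD
    obtain ⟨e', rfl⟩ : ∃ e', e = e' + 1 := by
      rcases Nat.eq_zero_or_pos e with h | h
      · rw [h, mul_zero] at he; omega
      · exact ⟨e - 1, by omega⟩
    have hq1 : 1 ≤ q := hq.one_lt.le
    have hD1 : D - 1 = (q - 1) + q * e' := by
      rw [he, Nat.mul_succ]
      generalize q * e' = t
      omega
    unfold Nat.ModEq at hmod
    rw [hD1, Nat.add_mul_mod_self_left, Nat.mod_eq_of_lt (by omega : q - 1 < q)] at hmod
    exact hmod

/-! ### 4. Reciprocity: for such `p`, `(q|p) = χ₄(q)` -/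

/-- If `p ≡ 1 (mod 4)` and `p ≡ -1 (mod q)` for an odd prime `q`, then `(q|p) = (p|q) = (-1|q) = χ₄(q)`. -/
theorem legendreSym_eq_chi4_of_neg_one_mod {p : ℕ} [Fact p.Prime] (hp4 : p % 4 = 1) {q : ℕ} (hq : q.Prime)
    (hq2 : q % 2 = 1) (hpq : p % q = q - 1) : legendreSym p q = ZMod.χ₄ (q : ZMod 4) := by
  haveI : Fact q.Prime := ⟨hq⟩
  have hq2' : q ≠ 2 := by rintro rfl; norm_num at hq2
  rw [← legendreSym.quadratic_reciprocity_one_mod_four hp4 hq2', legendreSym.mod q (p : ℤ)]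
  have hmod : ((p : ℤ) % (q : ℤ)) = ((q - 1 : ℕ) : ℤ) := by
    rw [← Int.natCast_mod, hpq]
  rw [hmod, Literature.NumberTheory.LFunctions.legendreSym_natCast_sub q (le_of_lt hq.one_lt)]
  simp only [Nat.cast_one]
  exact legendreSym.at_neg_one hq2'

/-- **Positive by-product** (Legendre symbols only): for every `K` and every bound `n₀` there is a prime `p > n₀`
(`p ≡ 5 (mod 8)`) whose partial sums vanish at `2, 4, 8, …, 2^{K+1}`: `S_p(2^{i+1}) = 0` for all `i ≤ K`. -/
theorem exists_prime_legendre_partial_sums_vanish (K n₀ : ℕ) :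
    ∃ (p : ℕ) (_ : Fact p.Prime), n₀ < p ∧ p % 8 = 5 ∧
      ∀ i : ℕ, i ≤ K → ∑ m ∈ range (2 ^ (i + 1) + 1), legendreSym p m = 0 := by
  obtain ⟨p, hpgt, hpp, hp8, hpq⟩ := exists_prime_five_mod_eight_and_neg_one_mod (2 ^ (K + 1)) n₀
  haveI hF : Fact p.Prime := ⟨hpp⟩
  have hp4 : p % 4 = 1 := by omega
  have h2 : legendreSym p 2 = -1 := legendreSym_two_of_mod_eight_eq_five p hp8
  have hpat := legendreSym_eq_chi4_of_prime p (2 ^ (K + 1))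
    (fun q hq hqN hq2 => legendreSym_eq_chi4_of_neg_one_mod hp4 hq hq2 (hpq q hq hqN hq2))
  exact ⟨p, hF, hpgt, hp8, fun i hi =>
    sum_legendreSym_two_pow_succ_eq_zero p (2 ^ (K + 1)) h2 hpat i (Nat.pow_le_pow_right (by norm_num) (by omega))⟩

/-! ### 5. The refutation of every `p - K` bound -/

/-- **UNBOUNDED PEEL DEFICIENCY — natural strengthening refuted for every constant.**  For every `K : ℕ`,
`∃ p₀ ∀ primes p ≥ p₀, every splitting A·B = F_p has |supp A| + |supp B| ≥ p - K` is FALSE: along the primes of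
`exists_prime_legendre_partial_sums_vanish` the peel `(X - X²)·Σ_k S_p(k+1) X^k` has `≥ K+1` vanishing cofactor
coefficients, i.e. support-sum `≤ p - K - 1`.  (The crux's `p^{1/2+δ}` and the line's `(p+3)/2` are untouched; this
bounds from above what ANY method can certify uniformly in `p`: not `p - O(1)`.) -/
theorem not_eventually_ge_sub_const (K : ℕ) :
    ¬ ∃ p₀ : ℕ, ∀ (p : ℕ) [Fact p.Prime], p₀ ≤ p → ∀ (A B : ℂ[X]),
      A * B = ∑ m ∈ Finset.range p, C ((legendreSym p m : ℤ) : ℂ) * X ^ m →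
        (p : ℝ) - K ≤ (A.support.card : ℝ) + (B.support.card : ℝ) := by
  rintro ⟨p₀, H⟩
  obtain ⟨p, hF, hpgt, hp8, hzero⟩ := exists_prime_legendre_partial_sums_vanish K (p₀ + 2 ^ (K + 1) + 2)
  have hKlt : K + 1 < 2 ^ (K + 1) := Nat.lt_two_pow_self
  have hp2 : p ≠ 2 := by omega
  obtain ⟨A, B, hAB, hA, hB⟩ := peel_split p hp2
  have hle : A.support.card + B.support.card ≤ p - (K + 1) := by
    classical
    set Z : Finset ℕ := (range (K + 1)).image (fun i => 2 ^ (i + 1) - 1) with hZ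
    have hZcard : Z.card = K + 1 := by
      rw [hZ, card_image_of_injective _ ?_, card_range]
      intro i j hij
      have h1 : 0 < 2 ^ (i + 1) := by positivity
      have h2' : 0 < 2 ^ (j + 1) := by positivity
      have hij' : 2 ^ (i + 1) - 1 = 2 ^ (j + 1) - 1 := hij
      have heq : 2 ^ (i + 1) = 2 ^ (j + 1) := by omega
      have := Nat.pow_right_injective (le_refl 2) heq
      omega
    have hZsub : Z ⊆ range (p - 2) := by
      intro k hk
      rw [hZ, mem_image] at hk
      obtain ⟨i, hi, rfl⟩ := hk
      rw [mem_range] at hi ⊢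
      have : 2 ^ (i + 1) ≤ 2 ^ (K + 1) := Nat.pow_le_pow_right (by norm_num) (by omega)
      omega
    have hsub : (range (p - 2)).filter (fun k => ∑ m ∈ range (k + 2), legendreSym p m ≠ 0) ⊆
        range (p - 2) \ Z := by
      intro k hk
      rw [mem_filter] at hk
      rw [mem_sdiff]
      refine ⟨hk.1, fun hkZ => hk.2 ?_⟩
      rw [hZ, mem_image] at hkZ
      obtain ⟨i, hi, rfl⟩ := hkZ
      rw [mem_range] at hi
      have h1 : 0 < 2 ^ (i + 1) := by positivity
      rw [show 2 ^ (i + 1) - 1 + 2 = 2 ^ (i + 1) + 1 by omega]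
      exact hzero i (by omega)
    have hcard := card_le_card hsub
    rw [card_sdiff_of_subset hZsub, card_range, hZcard] at hcard
    rw [hA, hB]
    omega
  have h := H p (by omega) A B hAB
  have hKp : K + 1 ≤ p := by omega
  have h' : ((A.support.card : ℝ) + (B.support.card : ℝ)) ≤ (p : ℝ) - (K + 1) := by
    have : ((A.support.card + B.support.card : ℕ) : ℝ) ≤ ((p - (K + 1) : ℕ) : ℝ) := by exact_mod_cast hle
    push_cast [Nat.cast_sub hKp] at this
    linarith
  linarith

end UnboundedDeficiency

end Summit.ValiantsHypothesis.Theorems.FeketeNoSparseSplit.Negative
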